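import Summits.Ventures.PercRepro.Night2LineIncome
import Summits.Ventures.PercRepro.Night2NonFatLineCell
import Summits.Ventures.PercRepro.Night2NonFatTen

/-!
# night-2: THE LONG-LINE CELL — h21's cell `(2, 1)` for `V` = a line of `≥ 24` points plus `≤ 100` points (gen 38)
Let `ℓ = cl {a′, b′}` carry `≥ 24` points of `V = G ∖ K` with `≤ 100` points of `V` off `ℓ`.  A basis pair with at most one basis
point on `ℓ` is LOSSLESS: at most two faces have `ℓ ⊆ cl (Q ∖ w)` (three would make `ℓ` the basis line of the other two basis
points), every other face misses `≥ 23` points (a hyperplane not containing `ℓ` meets it in `≤ 1` point), so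
`L1 Q ≤ 2 · 7/30 + 3 · 7/150 = 91/150 < 11/18 ≤ capS Q` (`loss_eq_zero_of_long_line`).  Two basis points `a, b` on `ℓ` give
`cl {a, b} = ℓ`, `d = |W ∩ ℓ| ≥ 22`, `k = |W ∖ ℓ| ≤ 97`: fair by the line theorem (`lineIncome 22 97 ≥ 1`; `k = 2` by gen 37's
line + 2).  **`localShadowHall_two_one_of_long_line`**: h21's cell `(2, 1)` for every such `G`.  Paper: proofs/NIGHT-2-g38.md §4.
-/

namespace PercRepro.Shadow

open PercRepro.ThmH PercRepro.PerFlat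

variable {α : Type*} [DecidableEq α] {M : Matroid α} [M.Finite] {G : Finset α}

/-- At least two points of `W` lie off any line: `rk W ≥ 4` while `W ∩ cl {a, b}` has rank `≤ 2`. -/
theorem two_le_card_sdiff_clF_pair' (hd : (gr M \ G).card = 2) {B : Finset α} (hB : B ∈ thinMembers M 5 G)
    (z : α) (a b : α) : 2 ≤ ((G \ insert z B) \ clF M {a, b}).card := by
  have h4 := four_le_rkN_sdiff_insert hd hB z
  have hsplit : G \ insert z B = ((G \ insert z B) ∩ clF M {a, b}) ∪ ((G \ insert z B) \ clF M {a, b}) := by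
    rw [Finset.union_comm, Finset.sdiff_union_inter]
  have h1 := rkN_union_le_rkN_add_card (M := M) ((G \ insert z B) ∩ clF M {a, b}) ((G \ insert z B) \ clF M {a, b})
  have h2 : rkN M ((G \ insert z B) ∩ clF M {a, b}) ≤ 2 :=
    le_trans (rkN_le_of_subset_clF' Finset.inter_subset_right) (le_trans (rkN_le_card _) Finset.card_le_two)
  rw [← hsplit] at h1
  omega

/-- Two distinct points of the line `cl {a′, b′}` span it: `cl {a, b} = cl {a′, b′}`. -/
theorem clF_pair_eq_of_mem (hs : ∀ e ∈ gr M, ∀ f ∈ gr M, e ≠ f → rkN M {e, f} = 2) {a' b' : α}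
    (ha' : a' ∈ gr M) (hb' : b' ∈ gr M) (hab' : a' ≠ b') {a b : α} (ha : a ∈ gr M) (hb : b ∈ gr M)
    (hab : a ≠ b) (hal : a ∈ clF M {a', b'}) (hbl : b ∈ clF M {a', b'}) : clF M {a, b} = clF M {a', b'} := by
  apply clF_eq_clF_of_subset_clF_of_rkN_le
  · intro x hx
    rw [Finset.mem_insert, Finset.mem_singleton] at hx
    rcases hx with rfl | rfl
    · exact ha'
    · exact hb'
  · intro x hx
    rw [Finset.mem_insert, Finset.mem_singleton] at hx
    rcases hx with rfl | rfl
    · exact hal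
    · exact hbl
  · rw [hs a' ha' b' hb' hab', hs a ha b hb hab]

/-- A hyperplane `cl (Q ∖ w)` not containing the line `ℓ` has at most one point of `V ∩ ℓ`, hence misses `≥ |V ∩ ℓ| − 1` points. -/
theorem card_sdiff_clF_erase_ge_of_not_subset
    (hs : ∀ e ∈ gr M, ∀ f ∈ gr M, e ≠ f → rkN M {e, f} = 2) {a' b' : α} (ha' : a' ∈ gr M) (hb' : b' ∈ gr M)
    (hab' : a' ≠ b') {S : Finset α} (hnot : ¬ clF M {a', b'} ⊆ clF M S) :
    ((G \ coloops M G) ∩ clF M {a', b'}).card ≤ (G \ clF M S).card + 1 := by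
  have hone : (clF M {a', b'} ∩ clF M S).card ≤ 1 := by
    by_contra h
    push Not at h
    obtain ⟨r₁, hr₁, r₂, hr₂, hne⟩ := Finset.one_lt_card.1 h
    apply hnot
    have hℓg : clF M {a', b'} ⊆ gr M := fun x hx => mem_gr_of_mem_clF hx
    have hrk : rkN M (clF M {a', b'}) ≤ 2 := by
      rw [rkN_clF, hs a' ha' b' hb' hab']
    exact subset_clF_of_rkN_le_two_of_two_mem hs hℓg hrk (Finset.mem_inter.1 hr₁).1
      (Finset.mem_inter.1 hr₂).1 hne (Finset.mem_inter.1 hr₁).2 (Finset.mem_inter.1 hr₂).2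
  have hsplit := Finset.card_sdiff_add_card_inter ((G \ coloops M G) ∩ clF M {a', b'}) (clF M S)
  have h1 : (((G \ coloops M G) ∩ clF M {a', b'}) \ clF M S).card ≤ (G \ clF M S).card :=
    Finset.card_le_card (Finset.sdiff_subset_sdiff (Finset.inter_subset_left.trans Finset.sdiff_subset)
      (Finset.Subset.refl _))
  have h2 : (((G \ coloops M G) ∩ clF M {a', b'}) ∩ clF M S).card ≤ (clF M {a', b'} ∩ clF M S).card :=
    Finset.card_le_card (Finset.inter_subset_inter Finset.inter_subset_right (Finset.Subset.refl _))
  omega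

/-- **At most two faces of a basis pair contain a line with at most one basis point**: three such faces force the line
to be the basis line of the two remaining basis points. -/
theorem card_filter_line_subset_le_two (hG : G ∈ flatsQ M (5 + 1)) (hd : (gr M \ G).card = 2)
    (hk : kColoops M G = 1) (hs : ∀ e ∈ gr M, ∀ f ∈ gr M, e ≠ f → rkN M {e, f} = 2) {B : Finset α}
    (hB : B ∈ thinMembers M 5 G) (hnP : ¬ bigP M G B) {z : α} (hz : z ∈ G \ clF M B) {a' b' : α}
    (ha' : a' ∈ G \ coloops M G) (hb' : b' ∈ G \ coloops M G) (hab' : a' ≠ b')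
    (hone : ((insert z B \ coloops M G) ∩ clF M {a', b'}).card ≤ 1) :
    ((insert z B \ coloops M G).filter (fun w => clF M {a', b'} ⊆ clF M ((insert z B).erase w))).card ≤ 2 := by
  have hd' : (gr M \ G).card ≤ 5 := by omega
  have hGg : G ⊆ gr M := (mem_flatsQ.1 hG).1
  have hQG : insert z B ⊆ G := Finset.insert_subset (Finset.mem_sdiff.1 hz).1 (subset_G_of_mem_thinMembers hB)
  have hKB : coloops M G ⊆ B := coloops_subset_of_mem_thinMembers hG hd' hB
  obtain ⟨-, hQ'5⟩ := rkN_insert_sdiff_coloops_eq_five hG hd hk hB hnP hz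
  by_contra h
  push Not at h
  obtain ⟨c, hc, d, hd₁, e, he, hcd, hce, hde⟩ := Finset.two_lt_card.1 h
  have hcQ' := (Finset.mem_filter.1 hc).1
  have hdQ' := (Finset.mem_filter.1 hd₁).1
  have heQ' := (Finset.mem_filter.1 he).1
  have hcl : clF M {a', b'} ⊆ clF M ((insert z B).erase c) := (Finset.mem_filter.1 hc).2
  have hdl : clF M {a', b'} ⊆ clF M ((insert z B).erase d) := (Finset.mem_filter.1 hd₁).2
  have hel : clF M {a', b'} ⊆ clF M ((insert z B).erase e) := (Finset.mem_filter.1 he).2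
  have hCQ' : ({c, d, e} : Finset α) ⊆ insert z B \ coloops M G := by
    intro x hx
    rw [Finset.mem_insert, Finset.mem_insert, Finset.mem_singleton] at hx
    rcases hx with rfl | rfl | rfl
    · exact hcQ'
    · exact hdQ'
    · exact heQ'
  have hC3 : ({c, d, e} : Finset α).card = 3 := by
    rw [Finset.card_insert_of_notMem, Finset.card_pair hde]
    rw [Finset.mem_insert, Finset.mem_singleton]
    push Not
    exact ⟨hcd, hce⟩
  have hrest : ((insert z B \ coloops M G) \ {c, d, e}).card = 2 := by
    rw [Finset.card_sdiff_of_subset hCQ', hQ'5, hC3]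
  obtain ⟨a, b, hab, hab_eq⟩ := Finset.card_eq_two.1 hrest
  have haQ' : a ∈ insert z B \ coloops M G := by
    have : a ∈ (insert z B \ coloops M G) \ {c, d, e} := by
      rw [hab_eq]
      exact Finset.mem_insert_self _ _
    exact (Finset.mem_sdiff.1 this).1
  have hbQ' : b ∈ insert z B \ coloops M G := by
    have : b ∈ (insert z B \ coloops M G) \ {c, d, e} := by
      rw [hab_eq]
      exact Finset.mem_insert_of_mem (Finset.mem_singleton_self _)
    exact (Finset.mem_sdiff.1 this).1
  have hcomm : (insert z B \ {c, d, e}) \ coloops M G = (insert z B \ coloops M G) \ {c, d, e} := by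
    ext x
    simp only [Finset.mem_sdiff]
    constructor
    · rintro ⟨⟨h1, h2⟩, h3⟩
      exact ⟨⟨h1, h3⟩, h2⟩
    · rintro ⟨⟨h1, h2⟩, h3⟩
      exact ⟨⟨h1, h3⟩, h2⟩
  have hmem : ∀ x ∈ G \ coloops M G, x ∈ clF M {a', b'} → x ∈ clF M {a, b} := by
    intro x hxV hxl
    have hxG : x ∈ G := (Finset.mem_sdiff.1 hxV).1
    have hyall : ∀ w ∈ ({c, d, e} : Finset α), x ∈ clF M ((insert z B).erase w) := by
      intro w hw
      rw [Finset.mem_insert, Finset.mem_insert, Finset.mem_singleton] at hw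
      rcases hw with rfl | rfl | rfl
      · exact hcl hxl
      · exact hdl hxl
      · exact hel hxl
    have hx1 := dead_mem_clF_of_three hG hd hk hB hnP hz (hCQ'.trans Finset.sdiff_subset) hxG hyall
    have hx2 := mem_clF_sdiff_coloops_of_mem_clF hG hk (Finset.sdiff_subset.trans hQG) hxV hx1
    rw [hcomm, hab_eq] at hx2
    exact hx2
  have ha'g : a' ∈ gr M := hGg (Finset.mem_sdiff.1 ha').1
  have hb'g : b' ∈ gr M := hGg (Finset.mem_sdiff.1 hb').1
  have hag : a ∈ gr M := hGg (hQG (Finset.mem_sdiff.1 haQ').1)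
  have hbg : b ∈ gr M := hGg (hQG (Finset.mem_sdiff.1 hbQ').1)
  have hab'g : ({a', b'} : Finset α) ⊆ gr M := by
    intro x hx
    rw [Finset.mem_insert, Finset.mem_singleton] at hx
    rcases hx with rfl | rfl
    · exact ha'g
    · exact hb'g
  have habg : ({a, b} : Finset α) ⊆ gr M := by
    intro x hx
    rw [Finset.mem_insert, Finset.mem_singleton] at hx
    rcases hx with rfl | rfl
    · exact hag
    · exact hbg
  have ha'l : a' ∈ clF M {a', b'} := subset_clF_of_subset_gr hab'g (Finset.mem_insert_self _ _)
  have hb'l : b' ∈ clF M {a', b'} :=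
    subset_clF_of_subset_gr hab'g (Finset.mem_insert_of_mem (Finset.mem_singleton_self _))
  have heq : clF M {a', b'} = clF M {a, b} :=
    clF_pair_eq_of_mem hs hag hbg hab ha'g hb'g hab' (hmem a' ha' ha'l) (hmem b' hb' hb'l)
  have hal : a ∈ clF M {a', b'} := by
    rw [heq]
    exact subset_clF_of_subset_gr habg (Finset.mem_insert_self _ _)
  have hbl : b ∈ clF M {a', b'} := by
    rw [heq]
    exact subset_clF_of_subset_gr habg (Finset.mem_insert_of_mem (Finset.mem_singleton_self _))
  have hsub : ({a, b} : Finset α) ⊆ (insert z B \ coloops M G) ∩ clF M {a', b'} := by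
    intro x hx
    rw [Finset.mem_insert, Finset.mem_singleton] at hx
    rcases hx with rfl | rfl
    · exact Finset.mem_inter.2 ⟨haQ', hal⟩
    · exact Finset.mem_inter.2 ⟨hbQ', hbl⟩
  have := Finset.card_le_card hsub
  rw [Finset.card_pair hab] at this
  omega

/-- **A basis pair with at most one basis point on a line carrying `≥ 24` points of `V` is lossless.** -/
theorem loss_eq_zero_of_long_line (hG : G ∈ flatsQ M (5 + 1)) (hd : (gr M \ G).card = 2)
    (hk : kColoops M G = 1) (hs : ∀ e ∈ gr M, ∀ f ∈ gr M, e ≠ f → rkN M {e, f} = 2)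
    (hnf : fatClosures M 5 G 2 = ∅) {B : Finset α} (hB : B ∈ thinMembers M 5 G) (hnP : ¬ bigP M G B)
    {z : α} (hz : z ∈ G \ clF M B) {a' b' : α} (ha' : a' ∈ G \ coloops M G) (hb' : b' ∈ G \ coloops M G)
    (hab' : a' ≠ b') (hlong : 24 ≤ ((G \ coloops M G) ∩ clF M {a', b'}).card)
    (hone : ((insert z B \ coloops M G) ∩ clF M {a', b'}).card ≤ 1) : loss M 5 G B z = 0 := by
  have hGg : G ⊆ gr M := (mem_flatsQ.1 hG).1
  have hQG : insert z B ⊆ G := Finset.insert_subset (Finset.mem_sdiff.1 hz).1 (subset_G_of_mem_thinMembers hB)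
  obtain ⟨-, hQ'5⟩ := rkN_insert_sdiff_coloops_eq_five hG hd hk hB hnP hz
  have ha'g : a' ∈ gr M := hGg (Finset.mem_sdiff.1 ha').1
  have hb'g : b' ∈ gr M := hGg (Finset.mem_sdiff.1 hb').1
  apply loss_eq_zero_of_unsat
  refine le_trans ?_ (capS_ge_eleven_eighteenths_two_one hd hk hQG)
  rw [L1_eq_sum_req_faces hG hd]
  set A : Finset α := (insert z B \ coloops M G).filter (fun w => faceOk M G (insert z B) w) with hAdef
  have hA5 : A.card ≤ 5 := by
    rw [← hQ'5]
    exact Finset.card_filter_le _ _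
  have hok : ∀ w ∈ A, faceOk M G (insert z B) w := fun w hw => (Finset.mem_filter.1 hw).2
  have hF2 : (A.filter (fun w => clF M {a', b'} ⊆ clF M ((insert z B).erase w))).card ≤ 2 := by
    refine le_trans (Finset.card_le_card ?_) (card_filter_line_subset_le_two hG hd hk hs hB hnP hz ha' hb' hab' hone)
    intro w hw
    rw [Finset.mem_filter] at hw ⊢
    exact ⟨(Finset.mem_filter.1 hw.1).1, hw.2⟩
  have hbig : ∀ w ∈ A, req M 5 ((insert z B).erase w) ≤ 7 / 30 := fun w hw =>
    req_le_of_nonfat hG hd hnf (hok w hw).1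
  have hsmall : ∀ w ∈ A, ¬ clF M {a', b'} ⊆ clF M ((insert z B).erase w) →
      req M 5 ((insert z B).erase w) ≤ 7 / 150 := by
    intro w hw hnot
    have hm := card_sdiff_clF_erase_ge_of_not_subset (G := G) hs ha'g hb'g hab' hnot
    have hm23 : (23 : ℚ) ≤ ((G \ clF M ((insert z B).erase w)).card : ℚ) := by exact_mod_cast (by omega : 23 ≤ _)
    rw [req_eq_of_thin hG (hok w hw).1, hd]
    unfold phiQ
    push_cast
    rw [div_le_div_iff₀ (by linarith) (by norm_num)]
    linarith
  rw [← Finset.sum_filter_add_sum_filter_not A (fun w => clF M {a', b'} ⊆ clF M ((insert z B).erase w))]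
  have hcards := Finset.card_filter_add_card_filter_not
    (s := A) (p := fun w => clF M {a', b'} ⊆ clF M ((insert z B).erase w))
  have h1 : ∑ w ∈ A.filter (fun w => clF M {a', b'} ⊆ clF M ((insert z B).erase w)),
      req M 5 ((insert z B).erase w) ≤
      ((A.filter (fun w => clF M {a', b'} ⊆ clF M ((insert z B).erase w))).card : ℚ) * (7 / 30) := by
    calc _ ≤ ∑ _w ∈ A.filter (fun w => clF M {a', b'} ⊆ clF M ((insert z B).erase w)), (7 / 30 : ℚ) :=
          Finset.sum_le_sum (fun w hw => hbig w (Finset.mem_filter.1 hw).1)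
      _ = _ := by rw [Finset.sum_const, nsmul_eq_mul]
  have h2 : ∑ w ∈ A.filter (fun w => ¬ clF M {a', b'} ⊆ clF M ((insert z B).erase w)),
      req M 5 ((insert z B).erase w) ≤
      ((A.filter (fun w => ¬ clF M {a', b'} ⊆ clF M ((insert z B).erase w))).card : ℚ) * (7 / 150) := by
    calc _ ≤ ∑ _w ∈ A.filter (fun w => ¬ clF M {a', b'} ⊆ clF M ((insert z B).erase w)), (7 / 150 : ℚ) :=
          Finset.sum_le_sum (fun w hw => hsmall w (Finset.mem_filter.1 hw).1 (Finset.mem_filter.1 hw).2)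
      _ = _ := by rw [Finset.sum_const, nsmul_eq_mul]
  have hf : ((A.filter (fun w => clF M {a', b'} ⊆ clF M ((insert z B).erase w))).card : ℚ) ≤ 2 := by
    exact_mod_cast hF2
  have hg : ((A.filter (fun w => ¬ clF M {a', b'} ⊆ clF M ((insert z B).erase w))).card : ℚ) ≤
      5 - ((A.filter (fun w => clF M {a', b'} ⊆ clF M ((insert z B).erase w))).card : ℚ) := by
    have : (A.filter (fun w => ¬ clF M {a', b'} ⊆ clF M ((insert z B).erase w))).card ≤
        5 - (A.filter (fun w => clF M {a', b'} ⊆ clF M ((insert z B).erase w))).card := by omega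
    have h5 : ((A.filter (fun w => clF M {a', b'} ⊆ clF M ((insert z B).erase w))).card : ℚ) ≤ 5 := by
      exact_mod_cast (by omega : _ ≤ 5)
    have := (Nat.cast_le (α := ℚ)).2 this
    rw [Nat.cast_sub (by omega)] at this
    push_cast at this
    linarith
  linarith

/-- **THE LONG-LINE CELL for lossy basis pairs**: two basis points on the line give the line theorem with `d ≥ 22`, `k ≤ 97`;
at most one basis point on the line gives a lossless pair. -/
theorem basis_pair_fair_of_long_line (hG : G ∈ flatsQ M (5 + 1)) (hd : (gr M \ G).card = 2)
    (hk : kColoops M G = 1) (hs : ∀ e ∈ gr M, ∀ f ∈ gr M, e ≠ f → rkN M {e, f} = 2)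
    (hl : ∀ e ∈ gr M, M.Indep {e}) (hnf : fatClosures M 5 G 2 = ∅) {B : Finset α}
    (hB : B ∈ thinMembers M 5 G) (hnP : ¬ bigP M G B) {z : α} (hz : z ∈ G \ clF M B)
    (hl0 : loss M 5 G B z ≠ 0) {a' b' : α} (ha' : a' ∈ G \ coloops M G) (hb' : b' ∈ G \ coloops M G)
    (hab' : a' ≠ b') (hlong : 24 ≤ ((G \ coloops M G) ∩ clF M {a', b'}).card)
    (hoff : ((G \ coloops M G) \ clF M {a', b'}).card ≤ 100) :
    loss M 5 G B z ≤ rhoL M 5 G B z * lossIncomeH M 5 G (bigP M G) (dshGT2 M 5 G) B z := by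
  have hGg : G ⊆ gr M := (mem_flatsQ.1 hG).1
  have hQG : insert z B ⊆ G := Finset.insert_subset (Finset.mem_sdiff.1 hz).1 (subset_G_of_mem_thinMembers hB)
  have hd' : (gr M \ G).card ≤ 5 := by omega
  have hKB : coloops M G ⊆ B := coloops_subset_of_mem_thinMembers hG hd' hB
  obtain ⟨-, hQ'5⟩ := rkN_insert_sdiff_coloops_eq_five hG hd hk hB hnP hz
  have ha'g : a' ∈ gr M := hGg (Finset.mem_sdiff.1 ha').1
  have hb'g : b' ∈ gr M := hGg (Finset.mem_sdiff.1 hb').1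
  rcases Nat.lt_or_ge ((insert z B \ coloops M G) ∩ clF M {a', b'}).card 2 with hlt | hge
  · exfalso
    exact hl0 (loss_eq_zero_of_long_line hG hd hk hs hnf hB hnP hz ha' hb' hab' hlong (by omega))
  obtain ⟨a, ha, b, hb, hab⟩ := Finset.one_lt_card.1 hge
  have haQ' := (Finset.mem_inter.1 ha).1
  have hbQ' := (Finset.mem_inter.1 hb).1
  have hag : a ∈ gr M := hGg (hQG (Finset.mem_sdiff.1 haQ').1)
  have hbg : b ∈ gr M := hGg (hQG (Finset.mem_sdiff.1 hbQ').1)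
  have heq : clF M {a, b} = clF M {a', b'} :=
    clF_pair_eq_of_mem hs ha'g hb'g hab' hag hbg hab (Finset.mem_inter.1 ha).2 (Finset.mem_inter.1 hb).2
  have hind : M.Indep ((insert z B \ coloops M G : Finset α) : Set α) :=
    (indep_insert_of_basis_pair hG hd hk hB hnP hz).subset (by exact_mod_cast (Finset.sdiff_subset))
  have hQ'ℓ : ((insert z B \ coloops M G) ∩ clF M {a, b}).card ≤ 2 :=
    card_inter_clF_pair_le_two_of_indep hind
  have hQ'split := Finset.card_sdiff_add_card_inter (insert z B \ coloops M G) (clF M {a, b})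
  have hVsplit : (G \ coloops M G) = (insert z B \ coloops M G) ∪ (G \ insert z B) := by
    ext x
    simp only [Finset.mem_sdiff, Finset.mem_union]
    constructor
    · rintro ⟨hxG, hxK⟩
      by_cases hxQ : x ∈ insert z B
      · exact Or.inl ⟨hxQ, hxK⟩
      · exact Or.inr ⟨hxG, hxQ⟩
    · rintro (⟨hxQ, hxK⟩ | ⟨hxG, hxQ⟩)
      · exact ⟨hQG hxQ, hxK⟩
      · refine ⟨hxG, fun hxK => hxQ (Finset.mem_insert_of_mem (hKB hxK))⟩
  have hdisj : Disjoint (insert z B \ coloops M G) (G \ insert z B) := by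
    rw [Finset.disjoint_left]
    intro x hx hx'
    exact (Finset.mem_sdiff.1 hx').2 (Finset.mem_sdiff.1 hx).1
  have hon : 22 ≤ ((G \ insert z B) ∩ clF M {a, b}).card := by
    have h := hlong
    rw [← heq, hVsplit, Finset.union_inter_distrib_right,
      Finset.card_union_of_disjoint (Finset.disjoint_of_subset_left Finset.inter_subset_left
        (Finset.disjoint_of_subset_right Finset.inter_subset_left hdisj))] at h
    omega
  have hoff' : ((G \ insert z B) \ clF M {a, b}).card ≤ 97 := by
    have h := hoff
    rw [← heq, hVsplit, Finset.union_sdiff_distrib,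
      Finset.card_union_of_disjoint (Finset.disjoint_of_subset_left Finset.sdiff_subset
        (Finset.disjoint_of_subset_right Finset.sdiff_subset hdisj))] at h
    omega
  have h2 := two_le_card_sdiff_clF_pair' hd hB z a b
  rcases Nat.lt_or_ge ((G \ insert z B) \ clF M {a, b}).card 3 with hlt3 | hge3
  · -- exactly two points off the line: gen 37's line + 2 theorem
    have hk2 : ((G \ insert z B) \ clF M {a, b}).card = 2 := by omega
    obtain ⟨y₁, y₂, hne, hy⟩ := Finset.card_eq_two.1 hk2
    have hy₁ : y₁ ∈ (G \ insert z B) \ clF M {a, b} := by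
      rw [hy]
      exact Finset.mem_insert_self _ _
    have hy₂ : y₂ ∈ (G \ insert z B) \ clF M {a, b} := by
      rw [hy]
      exact Finset.mem_insert_of_mem (Finset.mem_singleton_self _)
    have habQ' : ({a, b} : Finset α) ⊆ insert z B \ coloops M G := by
      intro x hx
      rw [Finset.mem_insert, Finset.mem_singleton] at hx
      rcases hx with rfl | rfl
      · exact haQ'
      · exact hbQ'
    have hA3 : ((insert z B \ coloops M G) \ {a, b}).card = 3 := by
      rw [Finset.card_sdiff_of_subset habQ', hQ'5, Finset.card_pair hab]
    apply basis_pair_fair_of_line_plus_two hG hd hk hs hl hnf hB hnP hz hl0 Finset.sdiff_subset hA3 hne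
      (Finset.mem_sdiff.1 hy₁).1 (Finset.mem_sdiff.1 hy₂).1
    intro y hyW hy1 hy2
    have hyl : y ∈ clF M {a, b} := by
      by_contra hnot
      have : y ∈ (G \ insert z B) \ clF M {a, b} := Finset.mem_sdiff.2 ⟨hyW, hnot⟩
      rw [hy, Finset.mem_insert, Finset.mem_singleton] at this
      rcases this with h | h
      · exact hy1 h
      · exact hy2 h
    have hmem : ({a, b} : Finset α) ⊆ insert z B \ ((insert z B \ coloops M G) \ {a, b}) := by
      intro x hx
      have hxab : x ∈ ({a, b} : Finset α) := hx
      rw [Finset.mem_insert, Finset.mem_singleton] at hx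
      rw [Finset.mem_sdiff, Finset.mem_sdiff]
      refine ⟨?_, fun h => h.2 hxab⟩
      rcases hx with rfl | rfl
      · exact (Finset.mem_sdiff.1 haQ').1
      · exact (Finset.mem_sdiff.1 hbQ').1
    have hcl : clF M {a, b} ⊆ clF M (insert z B \ ((insert z B \ coloops M G) \ {a, b})) :=
      clF_subset_clF_of_subset_clF (hmem.trans (subset_clF_of_subset_gr (Finset.sdiff_subset.trans (hQG.trans hGg))))
    exact hcl hyl
  · -- at least three points off the line: the line theorem with `d ≥ 22`, `k ≤ 97`
    apply basis_pair_fair_of_line_of_le hG hd hk hs hl hnf hB hnP hz hl0 haQ' hbQ' hab (Finset.Subset.refl _) hge3 ?_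
      (d₀ := 22) (k₀ := 97) hon hoff' ?_
    · rw [Finset.sdiff_self]
      have := rkN_le_card (M := M) (∅ : Finset α)
      rw [Finset.card_empty] at this
      omega
    · unfold lineIncome lineFaceBound
      simp only [Finset.sum_range_succ, Finset.sum_range_zero]
      norm_num [Nat.choose]

/-- **The cell `(2, 1)` with no fat closure, `V` = a line of `≥ 24` points plus `≤ 100` points.** -/
theorem localShadowHall_nonfat_of_long_line (hG : G ∈ flatsQ M (5 + 1)) (hd : (gr M \ G).card = 2)
    (hk : kColoops M G = 1) (hs : ∀ e ∈ gr M, ∀ f ∈ gr M, e ≠ f → rkN M {e, f} = 2)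
    (hl : ∀ e ∈ gr M, M.Indep {e}) (hnf : fatClosures M 5 G 2 = ∅) {a' b' : α}
    (ha' : a' ∈ G \ coloops M G) (hb' : b' ∈ G \ coloops M G) (hab' : a' ≠ b')
    (hlong : 24 ≤ ((G \ coloops M G) ∩ clF M {a', b'}).card)
    (hoff : ((G \ coloops M G) \ clF M {a', b'}).card ≤ 100) : LocalShadowHall M 5 G := by
  have hfat : (fatClosures M 5 G 2).card ≤ 1 := by
    rw [hnf, Finset.card_empty]
    exact zero_le_one
  apply localShadowHall_of_gt2_of_basis_fair hG hd hk hs hl hfat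
  intro B hB hnP z hz
  by_cases hl0 : loss M 5 G B z = 0
  · rw [hl0]
    have hd' : (gr M \ G).card ≤ 5 := by omega
    have h1 : 0 ≤ rhoL M 5 G B z := by
      unfold rhoL
      rw [hl0]
      simp
    have h2 : 0 ≤ lossIncomeH M 5 G (bigP M G) (dshGT2 M 5 G) B z :=
      lossIncomeH_nonneg hG hd' (column_side_gt2 hG hd hk hs hl hfat) B z
    positivity
  · exact basis_pair_fair_of_long_line hG hd hk hs hl hnf hB hnP hz hl0 ha' hb' hab' hlong hoff

/-- **h21's cell `(2, 1)` for `V` = a line of `≥ 24` points plus `≤ 100` points**: at least two fat closures (gen 28),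
exactly one (gen 36), or none (`localShadowHall_nonfat_of_long_line`). -/
theorem localShadowHall_two_one_of_long_line (hG : G ∈ flatsQ M (5 + 1)) (hd : (gr M \ G).card = 2)
    (hk : kColoops M G = 1) (hs : ∀ e ∈ gr M, ∀ f ∈ gr M, e ≠ f → rkN M {e, f} = 2)
    (hl : ∀ e ∈ gr M, M.Indep {e}) {a' b' : α} (ha' : a' ∈ G \ coloops M G) (hb' : b' ∈ G \ coloops M G)
    (hab' : a' ≠ b') (hlong : 24 ≤ ((G \ coloops M G) ∩ clF M {a', b'}).card)
    (hoff : ((G \ coloops M G) \ clF M {a', b'}).card ≤ 100) : LocalShadowHall M 5 G := by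
  rcases Nat.lt_or_ge (fatClosures M 5 G 2).card 2 with hlt | hge
  · rcases Nat.lt_or_ge (fatClosures M 5 G 2).card 1 with h0 | h1
    · have hnf : fatClosures M 5 G 2 = ∅ := Finset.card_eq_zero.1 (by omega)
      exact localShadowHall_nonfat_of_long_line hG hd hk hs hl hnf ha' hb' hab' hlong hoff
    · obtain ⟨B₀, hB₀, hm₀⟩ := exists_fat_member_of_card_eq_one hG hd (by omega)
      exact localShadowHall_fat hG hd hk hs hl (by omega) hB₀ hm₀
  · exact localShadowHall_two_one_five_fatClosures_free hG hd hk hs hl hge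

end PercRepro.Shadow
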